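import Literature.MathematicalPhysics.QuantumFieldTheory.Balaban1983to89.B9Eq325ProjFormulaZdLevels
import Literature.MathematicalPhysics.QuantumFieldTheory.Balaban1983to89.B7Eq43AveragingContinuity

/-!
# `Balaban1983to89.B9Eq325ProjContinuityZd` — [Balaban1985BackgroundPropagators] (3.20)–(3.25): THE LANDAU PROJECTION `R(U)` AND THE LETTER
# `D R(U) 𝟙D*` OF `Δ_a(U)` ARE CONTINUOUS IN THE BACKGROUND `U` (letter 3 of 4 for `B9Thm311PosDefOpenZd.LettersContinuousWithinAt`) — along every family
# of unitary backgrounds whose averaged transporters `Ūʲ(Γ)`, `j ≤ m`, are unitary and continuous and for which `Q′*` is injective: `G′(U) = (Ω₀Δ′_aΩ₀)⁻¹`,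
# `(Q′G′²Q′*)⁻¹`, the formula (3.25) and hence `R(U)` on Hermitian inputs depend continuously on `U`

statement-level skeleton of published theorems with citation tags; proofs where landed; nothing here is a claim about the
Yang–Mills mass gap

`[Balaban1985BackgroundPropagators]` ("B9", CMP **99** (1985) 389–434) p. 394 (3.20)–(3.25): *«R(U) denotes the orthogonal projection in this space onto
the subspace Δ^η_U N(Q′) … R(U) = I − G′(U)Q′*(U)(Q′(U)G′(U)²Q′*(U))⁻¹Q′(U)G′(U)»*, p. 395 (3.26) (`Δ_a = Δ + DRD* + Q*aQ`), p. 400 Thm 3.4 (the propagators as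
*«analytic functions»* of the background perturbation — the cell's fixed-lattice reading is CONTINUITY in `U`, which is all this file records: every
operator in (3.24)–(3.25) is a finite composition of bond variables, averaged transporters, Riesz transposes and INVERSES of invertible finite matrices).
PDF held: `paper:balaban1985-cmp99-background-propagators` pp. 393–395, 400 (re-read by this seat, 2026-08-28).

CITATION HEADER (lean-in-tree rule).  Cell `pub-ymgap` (YM Track A, HUMAN RULING D-0062 ∕ D-0149 width push), DAG node N06 = [B9], width seat
`pub-ymgap-dag-n06-w4` (g3), FILE 5 of the IDEA-3.11 STEP (ii) road: FILE 1 `B9Thm311PosDefOpenZd` (p605686; positivity open in `U₀` GIVEN letter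
continuity; `D*D` letter), FILE 2 `B9Eq310DeltaPrimeContinuityZd` (p606545; `Δ′`), FILE 3 `B7Eq43AveragingContinuity` (p606675; `V̄ʲ`, `Q_j(U₀)`), FILE 4
`B9Eq325ProjFormulaZdLevels` ((3.25) with `Ūʲ` unitary for `j ≤ m` only).  THIS FILE: the `D R(U₀) 𝟙_{Ω₀}D*` letter of this seat's g0 `opsLandau` (p585863) —
`R(U₀) = projE`, the `formE`-orthogonal projection onto `Δ^η_{U₀}N_𝔤(Q′(U₀))` — is continuous in `U₀`, through (3.25) (g2 objects `GpZd`, `QprimeVec`,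
`QprimeStar`, `qggq`, `cZd`, `Rop`: `B9Eq324DeltaPrimeAZd` p597448, `B9Eq325QGGQInvZd` p599165, `B9Eq325ProjFormulaZd` p600602 — all cited BY NAME).

WHAT IS PROVED (kernel, 0 sorry; theorems only — no `def`, `instance`, `notation`).  `U : Z → (bonds → 𝔸ˣ)` continuous at `z₀`; `hbgT` = continuity at `z₀` of
the averaged transporters `bgT L (U z) j y x`, `j ≤ m` (supplied by `continuousAt_bgT` from FILE 3 wherever the lower averages are in the disc of (21) — e.g.
at the flat background).
* §1 (linear algebra) ★★ `continuousAt_ofBijective_symm_apply` — on a finite-dimensional Hausdorff real topological vector space, a family `T z` of bijective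
  linear operators with `z ↦ T z v` continuous at `z₀` for every `v` has `z ↦ (T z)⁻¹(g z)` continuous at `z₀` for every `g` continuous at `z₀`
  (`LinearMap.toMatrix` in `Module.finBasis`, `Matrix.nonsing_inv`, Mathlib `continuousAt_matrix_inv`); ★ `continuousAt_riesz` (the Riesz vector of a
  pointwise-continuous family of functionals on the fibre).
* §2 (carrier) `finiteDimensional_suppSub'`, `continuousAt_re_tau` (FILE 3's `continuousAt_conjR` by name), `continuousAt_bondVar`, `continuousAt_covDerivFwd`, `continuousAt_covDeriv`,
  `continuousAt_covDivB`, `continuousAt_covLap` ((3.23)), ★ `continuousAt_QprimeIter` ((3.19), any blocking, continuous transporters), ★ `continuousAt_transposeOn`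
  (Riesz transposes with continuous entries), `continuousAt_deltaPrimeAZd_apply` ((3.24)), `continuousAt_suppSub_iff`, `continuousAt_levSupp_iff`,
  `continuousAt_deltaPrimeADom`, ★★ `continuousAt_GpZd` (`G′(U)`), `continuousAt_QprimeVec`, `continuousAt_QprimeStar`, `continuousAt_qggq`, ★★ `continuousAt_cZd`
  (`(Q′G′²Q′*)⁻¹`), ★★ `continuousAt_Rop` ((3.25)), ★★★ `continuousAt_projR_of_herm` (g0's `projR` on a continuous HERMITIAN family, unitary `U z` with `Ūʲ`
  unitary for `j ≤ m`, `Q′*` injective, via FILE 4's `projE_eq_Rop_of_herm_le`).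
* §3 (the letter) `continuousAt_bgT` (FILE 3), `isSelfAdjoint_covDivB`, ★★★ `continuousAt_DRDs_opsLandau` — at a member with finite `Ω₀` and finite constraint
  sets, for a Hermitian bond field `A`, `z ↦ (D R(U_z) 𝟙_{Ω₀}D* A)(b)` is continuous at `z₀` along such a family.

HONEST SCOPE.  Continuity bookkeeping + one linear-algebra lemma; no estimate of [B9] (Thms 3.1–3.4 bound these operators; here only their continuous
dependence on finitely many bond variables is recorded).  Three of the four letters of `opsAllZd`'s `Δ_a` are now continuous in the background (`D*D`, `Δ′`,
`D R D*`); `Q*aQ` and the assembly on dag-n06-w2 g3's regime set are the next file.  Count-neutral; N05 ∕ N06 NOT discharged; K1⁷ `stmt-QuantumFields-20542`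
NOT closed; Theorem 3.11 at curved `U₀` NOT proved; one finite `𝕋⁴` programme at fixed `ε`, Bałaban as printed; R4 closes only the conditional finite-`𝕋⁴`
rung `BalabanLadder.UV` — nothing continuum ∕ ℝ⁴ ∕ OS ∕ mass gap ∕ Clay.  Unit `pub-ymgap-dag-n06-w4` (g3), 2026-08-28.
-/

noncomputable section

namespace Literature.MathematicalPhysics.QuantumFieldTheory.Balaban1983to89.B9Eq325ProjContinuityZd

open Filter Topology Matrix

/-! ## §1  Linear algebra: the inverse of a continuously-parametrised invertible operator on a finite-dimensional space is continuous -/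

section Inverse

variable {Z : Type*} [TopologicalSpace Z] {V : Type*} [AddCommGroup V] [Module ℝ V] [TopologicalSpace V] [IsTopologicalAddGroup V]
  [ContinuousSMul ℝ V] [T2Space V] [FiniteDimensional ℝ V]

/-- coordinates in a basis of a finite-dimensional Hausdorff real vector space are continuous along a family continuous at `z₀`. [folklore] -/
private theorem continuousAt_repr {n : ℕ} (b : Module.Basis (Fin n) ℝ V) {f : Z → V} {z₀ : Z} (hf : ContinuousAt f z₀) (i : Fin n) :
    ContinuousAt (fun z => b.repr (f z) i) z₀ := by
  have h : Continuous fun v : V => b.coord i v := (b.coord i).continuous_of_finiteDimensional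
  exact h.continuousAt.comp hf

omit [T2Space V] [FiniteDimensional ℝ V] in
/-- a family is continuous at `z₀` if all its coordinates are. [folklore] -/
private theorem continuousAt_of_repr {n : ℕ} (b : Module.Basis (Fin n) ℝ V) {f : Z → V} {z₀ : Z}
    (hf : ∀ i : Fin n, ContinuousAt (fun z => b.repr (f z) i) z₀) : ContinuousAt f z₀ := by
  have h1 : ContinuousAt (fun z => (b.equivFun (f z) : Fin n → ℝ)) z₀ := continuousAt_pi.2 fun i => hf i
  have h2 : Continuous fun c : Fin n → ℝ => b.equivFun.symm c := (b.equivFun.symm : (Fin n → ℝ) →ₗ[ℝ] V).continuous_of_finiteDimensional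
  have h3 := h2.continuousAt.comp h1
  refine h3.congr (Eventually.of_forall fun z => ?_)
  simp only [Function.comp_apply, LinearEquiv.symm_apply_apply]

/-- ★★ **THE INVERSE OF A POINTWISE-CONTINUOUS FAMILY OF INVERTIBLE LINEAR OPERATORS ON A FINITE-DIMENSIONAL SPACE, APPLIED TO A CONTINUOUS VECTOR FAMILY, IS
CONTINUOUS**: `T z` bijective for all `z`, `z ↦ T z v` continuous at `z₀` for every `v`, `g` continuous at `z₀` ⟹ `z ↦ (T z)⁻¹ (g z)` continuous at
`z₀` (coordinates: the matrix of `T z` has continuous entries and non-vanishing determinant, its inverse is `adj ∕ det`). The mechanism behind the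
continuity in `U` of `G′(U) = (Ω₀Δ′_aΩ₀)⁻¹` and `(Q′G′²Q′*)⁻¹`. [cite: Balaban1985BackgroundPropagators, (3.24)–(3.25) p.394 (bookkeeping: finite-dimensional inverse continuity, not a printed statement)] -/
theorem continuousAt_ofBijective_symm_apply (T : Z → V →ₗ[ℝ] V) (hT : ∀ z, Function.Bijective (T z)) {z₀ : Z}
    (hc : ∀ v : V, ContinuousAt (fun z => T z v) z₀) {g : Z → V} (hg : ContinuousAt g z₀) :
    ContinuousAt (fun z => (LinearEquiv.ofBijective (T z) (hT z)).symm (g z)) z₀ := by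
  classical
  set n : ℕ := Module.finrank ℝ V
  let b : Module.Basis (Fin n) ℝ V := Module.finBasis ℝ V
  let M : Z → Matrix (Fin n) (Fin n) ℝ := fun z => LinearMap.toMatrix b b (T z)
  have hM : ContinuousAt M z₀ := by
    refine continuousAt_pi.2 fun i => continuousAt_pi.2 fun j => ?_
    have h := continuousAt_repr b (hc (b j)) i
    refine h.congr (Eventually.of_forall fun z => ?_)
    simp only [M, LinearMap.toMatrix_apply]
  have hdet : ∀ z, (M z).det ≠ 0 := by
    intro z
    have hu : IsUnit (T z) :=
      (LinearMap.isUnit_iff_ker_eq_bot (T z)).2 (LinearMap.ker_eq_bot.2 (hT z).1)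
    have h := (LinearMap.isUnit_iff_isUnit_det (T z)).1 hu
    rw [← LinearMap.det_toMatrix b] at h
    exact h.ne_zero
  have hinv : ContinuousAt (fun z => (M z)⁻¹) z₀ := by
    have hR : ContinuousAt Ring.inverse (M z₀).det := by
      have := NormedRing.inverse_continuousAt (Units.mk0 _ (hdet z₀))
      rwa [Units.val_mk0] at this
    exact (continuousAt_matrix_inv (M z₀) hR).comp hM
  -- coordinates of the inverse
  have hcoord : ∀ (z : Z) (w : V) (i : Fin n),
      b.repr ((LinearEquiv.ofBijective (T z) (hT z)).symm w) i = ((M z)⁻¹ *ᵥ fun j => b.repr w j) i := by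
    intro z w i
    set v := (LinearEquiv.ofBijective (T z) (hT z)).symm w with hv
    have h1 : M z *ᵥ (fun j => b.repr v j) = fun j => b.repr (T z v) j := by
      have := LinearMap.toMatrix_mulVec_repr b b (T z) v
      exact this
    have h2 : T z v = w := by
      rw [hv, ← LinearEquiv.ofBijective_apply (hf := hT z), LinearEquiv.apply_symm_apply]
    rw [h2] at h1
    have h3 : (M z)⁻¹ *ᵥ (M z *ᵥ fun j => b.repr v j) = fun j => b.repr v j := by
      rw [Matrix.mulVec_mulVec, Matrix.nonsing_inv_mul _ ((isUnit_iff_ne_zero).2 (hdet z)), Matrix.one_mulVec]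
    rw [← h1, h3]
  refine continuousAt_of_repr b fun i => ?_
  have hfun : (fun z => b.repr ((LinearEquiv.ofBijective (T z) (hT z)).symm (g z)) i) =
      fun z => ∑ j, (M z)⁻¹ i j * b.repr (g z) j := by
    funext z
    rw [hcoord]
    rfl
  rw [hfun]
  refine tendsto_finsetSum _ fun j _ => ?_
  exact ((continuousAt_pi.1 (continuousAt_pi.1 hinv i) j)).mul (continuousAt_repr b hg j)

end Inverse

/-! ## §1b  The Riesz vector of a continuously-parametrised functional is continuous -/

section Riesz

open B9Eq324DeltaPrimeAZd (riesz)

variable {Z : Type*} [TopologicalSpace Z] {𝔸 : Type*} [CStarAlgebra 𝔸] [FiniteDimensional ℝ 𝔸] (τ : 𝔸 →ₗ[ℂ] ℂ)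
  (hτp : ∀ a : 𝔸, a ≠ 0 → 0 < (τ (star a * a)).re)

/-- ★ **THE RIESZ VECTOR OF A POINTWISE-CONTINUOUS FAMILY OF FUNCTIONALS IS CONTINUOUS** (finite-dimensional fibre): if `z ↦ φ_z(X)` is continuous at
`z₀` for every `X`, so is `z ↦ riesz φ_z` (expand `φ_z = Σ_i φ_z(b_i)·b^i` in a basis). [cite: Balaban1985BackgroundPropagators, p.391 («the adjoints are taken with respect to natural L² scalar products») (bookkeeping)] -/
theorem continuousAt_riesz {φ : Z → (𝔸 →ₗ[ℝ] ℝ)} {z₀ : Z} (h : ∀ X : 𝔸, ContinuousAt (fun z => φ z X) z₀) :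
    ContinuousAt (fun z => riesz τ hτp (φ z)) z₀ := by
  classical
  let b := Module.finBasis ℝ 𝔸
  have hsum : ∀ z, riesz τ hτp (φ z) = ∑ i, φ z (b i) • riesz τ hτp (b.coord i) := by
    intro z
    conv_lhs => rw [← Module.Basis.sum_dual_apply_smul_coord b (φ z)]
    simp only [riesz, map_sum, map_smul]
  have hfun : (fun z => riesz τ hτp (φ z)) = fun z => ∑ i, φ z (b i) • riesz τ hτp (b.coord i) := funext hsum
  rw [hfun]
  refine tendsto_finsetSum _ fun i _ => ?_
  exact (h (b i)).smul continuousAt_const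

end Riesz

/-! ## §2  The `ℤᵈ × 𝔸` carrier: the constituents of (3.24)–(3.25) are continuous in the background -/

section Carrier

open B7Prop1Explicit
open B7Prop2Explicit (unitaryUnits avgIter)
open B7Eq78Linearization (conjR Blocking Qprime Qprime_apply QprimeIter QprimeIter_zero QprimeIter_succ zdBlocking)
open B8Eq119TwistedAxial (bgT)
open B8Ineq132 (covDerivFwd covDeriv)
open B8Eq138LandauZd (covDivB covLap)
open B9Eq321LandauProjectionZd (suppSub projE projR star_covDeriv)
open B9Eq324DeltaPrimeAZd (riesz single transposeOn rowFunctional_apply QprimeLin QprimeLin_apply deltaPrimeAZd deltaPrimeAZd_apply deltaPrimeADom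
  deltaPrimeADom_coe deltaPrimeADom_bijective GpZd)
open B9Eq325QGGQInvZd (levSupp QprimeVec QprimeStar QprimeStar_coe qggq qggq_apply qggq_bijective cZd QprimeStarInjective finiteDimensional_levSupp)
open B9Eq325ProjFormulaZd (starSub starFun Rop)
open B9Eq325ProjFormulaZdLevels (projE_eq_Rop_of_herm_le)
open B7Eq43AveragingContinuity (continuousAt_conjR)

-- `Site` alone could resolve to the torus sites of `Setup.lean`; re-export the `ℤ^d` sites of `B7Prop1Explicit`.
export B7Prop1Explicit (Site)

variable {d : ℕ} {𝔸 : Type*} [CStarAlgebra 𝔸] {Z : Type*} [TopologicalSpace Z] {z₀ : Z}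

/-- `E = L²(Ω₀, ·)` is finite-dimensional for a finite-dimensional fibre (restriction to the finite `Ω₀` is injective).
[cite: Balaban1985BackgroundPropagators, (3.21) p.394 (bookkeeping)] -/
theorem finiteDimensional_suppSub' [FiniteDimensional ℝ 𝔸] (s : Finset (Site d)) : FiniteDimensional ℝ (suppSub (𝔸 := 𝔸) s) := by
  let res : suppSub (𝔸 := 𝔸) s →ₗ[ℝ] (↥s → 𝔸) :=
    { toFun := fun f x => (f : Site d → 𝔸) x
      map_add' := fun f g => rfl
      map_smul' := fun c f => rfl }
  refine FiniteDimensional.of_injective res fun f g h => ?_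
  apply Subtype.ext
  funext x
  by_cases hx : x ∈ s
  · exact congr_fun h ⟨x, hx⟩
  · rw [f.2 x hx, g.2 x hx]

/-- the fibre pairing `(a, b) ↦ Re τ(a* b)` along arguments continuous at `z₀` (finite-dimensional fibre). [cite: Balaban1985BackgroundPropagators, p.391 («X·Y = tr XY»)] -/
theorem continuousAt_re_tau [FiniteDimensional ℝ 𝔸] (τ : 𝔸 →ₗ[ℂ] ℂ) {a b : Z → 𝔸} (ha : ContinuousAt a z₀) (hb : ContinuousAt b z₀) :
    ContinuousAt (fun z => (τ (star (a z) * b z)).re) z₀ := by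
  have hτ : Continuous fun X : 𝔸 => τ X := (τ.restrictScalars ℝ).continuous_of_finiteDimensional
  exact Complex.continuous_re.continuousAt.comp (hτ.continuousAt.comp ((continuous_star.continuousAt.comp ha).mul hb))

variable {U : Z → Site d → Fin d → 𝔸ˣ} (hU : ContinuousAt U z₀)

include hU in
/-- a bond variable is continuous in the background. [cite: Balaban1985RegularSpaces, (1.1) p.76 (bookkeeping)] -/
theorem continuousAt_bondVar (x : Site d) (μ : Fin d) : ContinuousAt (fun z => U z x μ) z₀ := by
  have h : Continuous fun V : Site d → Fin d → 𝔸ˣ => V x μ := (continuous_apply μ).comp (continuous_apply x)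
  exact h.continuousAt.comp hU

include hU in
/-- **(1.1): the forward covariant derivative of a background-dependent site function is continuous in the background.** [cite: Balaban1985RegularSpaces, (1.1) p.76] -/
theorem continuousAt_covDerivFwd (η : ℝ) (μ : Fin d) (x : Site d) {F : Z → Site d → 𝔸} (hF₁ : ContinuousAt (fun z => F z (x + e μ)) z₀)
    (hF₀ : ContinuousAt (fun z => F z x) z₀) : ContinuousAt (fun z => covDerivFwd η (U z) μ (F z) x) z₀ := by
  unfold covDerivFwd
  exact ((continuousAt_conjR (continuousAt_bondVar hU x μ) hF₁).sub hF₀).const_smul _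

include hU in
/-- **(1.1): the backward covariant derivative of a background-dependent site function is continuous in the background.** [cite: Balaban1985RegularSpaces, (1.1) p.76] -/
theorem continuousAt_covDeriv (η : ℝ) (ν : Fin d) (x : Site d) {F : Z → Site d → 𝔸} (hF₁ : ContinuousAt (fun z => F z (x - e ν)) z₀)
    (hF₀ : ContinuousAt (fun z => F z x) z₀) : ContinuousAt (fun z => covDeriv η (U z) ν (F z) x) z₀ := by
  unfold covDeriv
  exact ((continuousAt_conjR (continuousAt_bondVar hU (x - e ν) ν).inv hF₁).sub hF₀).const_smul _

include hU in
/-- **the covariant divergence `D^{η*}_U A` of a background-dependent bond field is continuous in the background.** [cite: Balaban1985BackgroundPropagators, (3.8) p.392] -/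
theorem continuousAt_covDivB (η : ℝ) (x : Site d) {A : Z → Site d → Fin d → 𝔸} (hA : ∀ (y : Site d) (μ : Fin d), ContinuousAt (fun z => A z y μ) z₀) :
    ContinuousAt (fun z => covDivB η (U z) (A z) x) z₀ := by
  unfold covDivB
  exact tendsto_finsetSum _ fun μ _ => continuousAt_covDeriv hU η μ x (hA _ μ) (hA x μ)

include hU in
/-- **(3.23): `Δ^η_U f` of a background-dependent site function is continuous in the background.** [cite: Balaban1985BackgroundPropagators, (3.23) p.394] -/
theorem continuousAt_covLap (η : ℝ) (x : Site d) {F : Z → Site d → 𝔸} (hF : ∀ y : Site d, ContinuousAt (fun z => F z y) z₀) :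
    ContinuousAt (fun z => covLap η (U z) (F z) x) z₀ := by
  unfold covLap
  exact continuousAt_covDivB hU η x fun y μ => continuousAt_covDerivFwd hU η μ y (hF _) (hF y)

/-- **(3.19): the composite averaging `Q′_j` of a background-dependent gauge function is continuous in the background**, given the continuity of the level
transporters `Ū₀ʲ(Γ_{y,x})` it uses (any blocking). [cite: Balaban1985BackgroundPropagators, (3.19) p.393; Balaban1985Averaging, (78) p.30] -/
theorem continuousAt_QprimeIter {ι : Type*} (G : Blocking ι) {T : Z → ℕ → ι → ι → 𝔸ˣ} {n : ℕ}
    (hT : ∀ j, j < n → ∀ (y x : ι), ContinuousAt (fun z => T z j y x) z₀) {f : Z → ι → 𝔸} (hf : ∀ x : ι, ContinuousAt (fun z => f z x) z₀) :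
    ∀ j, j ≤ n → ∀ y : ι, ContinuousAt (fun z => QprimeIter G (T z) j (f z) y) z₀
  | 0, _, y => by simp only [QprimeIter_zero]; exact hf y
  | j + 1, hj, y => by
    simp only [QprimeIter_succ, Qprime_apply]
    refine tendsto_finsetSum _ fun x _ => ?_
    exact (continuousAt_conjR (hT j (Nat.lt_of_succ_le hj) y x) (continuousAt_QprimeIter G hT hf j (Nat.le_of_succ_le hj) x)).const_smul _

variable [FiniteDimensional ℝ 𝔸] (τ : 𝔸 →ₗ[ℂ] ℂ) (hτp : ∀ a : 𝔸, a ≠ 0 → 0 < (τ (star a * a)).re)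

/-- **THE `τ`-TRANSPOSE `Tᵀ_Λ g` IS CONTINUOUS IN THE BACKGROUND** for a background-dependent operator `T_z` whose matrix entries `(T_z(single i X))(c)`,
`c ∈ Λ`, are continuous, and a background-dependent `g_z` continuous on `Λ` (Riesz vectors of pointwise-continuous functionals).
[cite: Balaban1985BackgroundPropagators, (3.24) p.394 («Q′*aQ′ is defined by the same quadratic form»), p.391] -/
theorem continuousAt_transposeOn {ι : Type*} {T : Z → (ι → 𝔸) →ₗ[ℝ] (ι → 𝔸)} {Λ : Finset ι} {g : Z → ι → 𝔸}
    (hT : ∀ (i : ι) (X : 𝔸), ∀ c ∈ Λ, ContinuousAt (fun z => T z (single i X) c) z₀) (hg : ∀ c ∈ Λ, ContinuousAt (fun z => g z c) z₀) (i : ι) :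
    ContinuousAt (fun z => transposeOn τ hτp (T z) Λ (g z) i) z₀ := by
  unfold transposeOn
  refine continuousAt_riesz τ hτp fun X => ?_
  simp only [rowFunctional_apply]
  exact tendsto_finsetSum _ fun c hc => continuousAt_re_tau τ (hT i X c hc) (hg c hc)

variable (L : ℕ) (η : ℝ) (m : ℕ) (a : ℕ → ℝ) (Λ : ℕ → Finset (Site d)) (s : Finset (Site d))
variable (hbgT : ∀ j, j < m + 1 → ∀ (y x : Site d), ContinuousAt (fun z => bgT L (U z) j y x) z₀)

include hU hbgT in
/-- **(3.24): `Δ′_a(U)f` of a background-dependent site function is continuous in the background** (given the continuity of the level transporters up to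
level `m`). [cite: Balaban1985BackgroundPropagators, (3.24) p.394] -/
theorem continuousAt_deltaPrimeAZd_apply {F : Z → Site d → 𝔸} (hF : ∀ y : Site d, ContinuousAt (fun z => F z y) z₀) (x : Site d) :
    ContinuousAt (fun z => deltaPrimeAZd L (U z) η τ hτp m a Λ (F z) x) z₀ := by
  simp only [deltaPrimeAZd_apply]
  refine (continuousAt_covLap hU η x hF).add (tendsto_finsetSum _ fun j hj => ?_)
  have hjm : j ≤ m := Nat.lt_succ_iff.1 (Finset.mem_range.1 hj)
  refine (continuousAt_transposeOn τ hτp (T := fun z => QprimeLin L (U z) j) (fun i X c _ => ?_) (fun c _ => ?_) x).const_smul _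
  · simp only [QprimeLin_apply]
    exact continuousAt_QprimeIter (zdBlocking d L) hbgT (f := fun _ => single i X) (fun _ => continuousAt_const) j (Nat.le_succ_of_le hjm) c
  · exact continuousAt_QprimeIter (zdBlocking d L) hbgT hF j (Nat.le_succ_of_le hjm) c

omit [FiniteDimensional ℝ 𝔸] in
/-- a family in `L²(Ω₀, ·)` is continuous at `z₀` iff its site values are. [cite: Balaban1985BackgroundPropagators, (3.21) p.394 (bookkeeping)] -/
theorem continuousAt_suppSub_iff {F : Z → suppSub (𝔸 := 𝔸) s} :
    ContinuousAt F z₀ ↔ ∀ x : Site d, ContinuousAt (fun z => (F z : Site d → 𝔸) x) z₀ := by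
  rw [Topology.IsInducing.subtypeVal.continuousAt_iff, continuousAt_pi]
  rfl

omit [FiniteDimensional ℝ 𝔸] in
/-- a family in `L²(𝔅, ·)` is continuous at `z₀` iff its values are. [cite: Balaban1985BackgroundPropagators, (3.24) p.394 (bookkeeping)] -/
theorem continuousAt_levSupp_iff {Φ : Z → levSupp (𝔸 := 𝔸) m Λ} :
    ContinuousAt Φ z₀ ↔ ∀ p : ℕ × Site d, ContinuousAt (fun z => (Φ z : ℕ × Site d → 𝔸) p) z₀ := by
  rw [Topology.IsInducing.subtypeVal.continuousAt_iff, continuousAt_pi]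
  rfl

include hU hbgT in
/-- **`Ω₀Δ′_a(U)Ω₀` applied to a continuous family of `L²(Ω₀, ·)` is continuous in the background.** [cite: Balaban1985BackgroundPropagators, (3.24) p.394] -/
theorem continuousAt_deltaPrimeADom {F : Z → suppSub (𝔸 := 𝔸) s} (hF : ContinuousAt F z₀) :
    ContinuousAt (fun z => deltaPrimeADom L (U z) η τ hτp m a Λ s (F z)) z₀ := by
  rw [continuousAt_suppSub_iff] at hF ⊢
  intro x
  simp only [deltaPrimeADom_coe]
  by_cases hx : x ∈ (↑s : Set (Site d))
  · simp only [Set.indicator_of_mem hx]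
    exact continuousAt_deltaPrimeAZd_apply (hU := hU) (τ := τ) (hτp := hτp) (L := L) (η := η) (m := m) (a := a) (Λ := Λ) (hbgT := hbgT) hF x
  · simp only [Set.indicator_of_notMem hx]
    exact continuousAt_const

variable (hd : 0 < d) (hη : η ≠ 0) (hτt : ∀ a b : 𝔸, τ (a * b) = τ (b * a)) (hτs : ∀ a : 𝔸, τ (star a) = starRingEnd ℂ (τ a))
  (hUu : ∀ (z : Z) (x : Site d) (κ : Fin d), U z x κ ∈ unitaryUnits 𝔸) (ha : ∀ j, 0 ≤ a j)

include hU hbgT in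
/-- ★★ **`G′(U) = (Ω₀Δ′_a(U)Ω₀)⁻¹` APPLIED TO A CONTINUOUS FAMILY IS CONTINUOUS IN THE BACKGROUND** (every unitary family, `a ≥ 0`, finite `Ω₀`; §1 applied to the
bijective family `Ω₀Δ′_a(U_z)Ω₀`). [cite: Balaban1985BackgroundPropagators, (3.24) p.394 («Its inverse is denoted by G′, or G′(U)»), Thm 3.11 p.416] -/
theorem continuousAt_GpZd {F : Z → suppSub (𝔸 := 𝔸) s} (hF : ContinuousAt F z₀) :
    ContinuousAt (fun z => GpZd L (U z) η τ hτp m a Λ s hd hη hτt hτs (hUu z) ha (F z)) z₀ := by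
  haveI := finiteDimensional_suppSub' (𝔸 := 𝔸) s
  unfold GpZd
  exact continuousAt_ofBijective_symm_apply (fun z => deltaPrimeADom L (U z) η τ hτp m a Λ s)
    (fun z => deltaPrimeADom_bijective L (U z) η τ hτp m a Λ s hd hη hτt hτs (hUu z) ha)
    (fun v => continuousAt_deltaPrimeADom (hU := hU) (τ := τ) (hτp := hτp) (L := L) (η := η) (m := m) (a := a) (Λ := Λ) (s := s)
      (hbgT := hbgT) continuousAt_const) hF

include hbgT in
omit [FiniteDimensional ℝ 𝔸] in
/-- **`Q′` applied to a continuous family of `L²(Ω₀, ·)` is continuous in the background.** [cite: Balaban1985BackgroundPropagators, (3.18)–(3.19) p.393] -/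
theorem continuousAt_QprimeVec {F : Z → suppSub (𝔸 := 𝔸) s} (hF : ContinuousAt F z₀) :
    ContinuousAt (fun z => QprimeVec L (U z) m Λ s (F z)) z₀ := by
  rw [continuousAt_suppSub_iff] at hF
  rw [continuousAt_levSupp_iff]
  intro p
  by_cases hp : p.1 ∈ Finset.range (m + 1) ∧ p.2 ∈ Λ p.1
  · have hjm : p.1 ≤ m := Nat.lt_succ_iff.1 (Finset.mem_range.1 hp.1)
    have h := continuousAt_QprimeIter (zdBlocking d L) hbgT hF p.1 (Nat.le_succ_of_le hjm) p.2
    refine h.congr (Eventually.of_forall fun z => ?_)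
    show _ = (if p.1 ∈ Finset.range (m + 1) ∧ p.2 ∈ Λ p.1 then _ else _)
    rw [if_pos hp]
  · refine (continuousAt_const (y := (0 : 𝔸))).congr (Eventually.of_forall fun z => ?_)
    show (0 : 𝔸) = (if p.1 ∈ Finset.range (m + 1) ∧ p.2 ∈ Λ p.1 then _ else _)
    rw [if_neg hp]

include hbgT in
/-- **`Q′*` applied to a continuous family of `L²(𝔅, ·)` is continuous in the background** (Riesz transposes of `Q′_j(U)`, continuous entries).
[cite: Balaban1985BackgroundPropagators, (3.25) p.394 («Q′*»), p.391] -/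
theorem continuousAt_QprimeStar {Φ : Z → levSupp (𝔸 := 𝔸) m Λ} (hΦ : ContinuousAt Φ z₀) :
    ContinuousAt (fun z => QprimeStar L (U z) τ m Λ s hτp (Φ z)) z₀ := by
  rw [continuousAt_levSupp_iff] at hΦ
  rw [continuousAt_suppSub_iff]
  intro x
  simp only [QprimeStar_coe]
  by_cases hx : x ∈ (↑s : Set (Site d))
  · simp only [Set.indicator_of_mem hx, Finset.sum_apply]
    refine tendsto_finsetSum _ fun j hj => ?_
    have hjm : j ≤ m := Nat.lt_succ_iff.1 (Finset.mem_range.1 hj)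
    refine continuousAt_transposeOn τ hτp (T := fun z => QprimeLin L (U z) j) (fun i X c _ => ?_) (fun c _ => hΦ (j, c)) x
    simp only [QprimeLin_apply]
    exact continuousAt_QprimeIter (zdBlocking d L) hbgT (f := fun _ => single i X) (fun _ => continuousAt_const) j (Nat.le_succ_of_le hjm) c
  · simp only [Set.indicator_of_notMem hx]
    exact continuousAt_const

include hU hbgT in
/-- **`Q′G′(U)²Q′*` applied to a continuous family is continuous in the background.** [cite: Balaban1985BackgroundPropagators, (3.25) p.394] -/
theorem continuousAt_qggq {Φ : Z → levSupp (𝔸 := 𝔸) m Λ} (hΦ : ContinuousAt Φ z₀) :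
    ContinuousAt (fun z => qggq L (U z) η τ hτp m a Λ s hd hη hτt hτs (hUu z) ha (Φ z)) z₀ := by
  simp only [qggq_apply]
  exact continuousAt_QprimeVec (L := L) (m := m) (Λ := Λ) (s := s) (hbgT := hbgT)
    (continuousAt_GpZd (hU := hU) (τ := τ) (hτp := hτp) (L := L) (η := η) (m := m) (a := a) (Λ := Λ) (s := s) (hbgT := hbgT) (hd := hd) (hη := hη) (hτt := hτt) (hτs := hτs) (hUu := hUu) (ha := ha)
      (continuousAt_GpZd (hU := hU) (τ := τ) (hτp := hτp) (L := L) (η := η) (m := m) (a := a) (Λ := Λ) (s := s) (hbgT := hbgT) (hd := hd) (hη := hη) (hτt := hτt) (hτs := hτs) (hUu := hUu) (ha := ha)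
        (continuousAt_QprimeStar (τ := τ) (hτp := hτp) (L := L) (m := m) (Λ := Λ) (s := s) (hbgT := hbgT) hΦ)))

variable (hinj : ∀ z : Z, QprimeStarInjective L (U z) τ hτp m Λ s)

include hU hbgT in
/-- ★★ **`(Q′G′(U)²Q′*)⁻¹` APPLIED TO A CONTINUOUS FAMILY IS CONTINUOUS IN THE BACKGROUND** (where `Q′*` is injective along the family; §1 again).
[cite: Balaban1985BackgroundPropagators, (3.25) p.394, Thm 3.11 p.416 («(Q′G′²Q′*)⁻¹ … positive definite»)] -/
theorem continuousAt_cZd {Φ : Z → levSupp (𝔸 := 𝔸) m Λ} (hΦ : ContinuousAt Φ z₀) :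
    ContinuousAt (fun z => cZd L (U z) η τ hτp m a Λ s hd hη hτt hτs (hUu z) ha (hinj z) (Φ z)) z₀ := by
  haveI := finiteDimensional_levSupp (𝔸 := 𝔸) m Λ
  unfold cZd
  exact continuousAt_ofBijective_symm_apply (fun z => qggq L (U z) η τ hτp m a Λ s hd hη hτt hτs (hUu z) ha)
    (fun z => qggq_bijective L (U z) η τ hτp m a Λ s hd hη hτt hτs (hUu z) ha (hinj z))
    (fun v => continuousAt_qggq (hU := hU) (τ := τ) (hτp := hτp) (L := L) (η := η) (m := m) (a := a) (Λ := Λ) (s := s) (hbgT := hbgT)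
      (hd := hd) (hη := hη) (hτt := hτt) (hτs := hτs) (hUu := hUu) (ha := ha) continuousAt_const) hΦ

include hU hbgT in
/-- ★★ **(3.25) `R(U)f = f − G′Q′*(Q′G′²Q′*)⁻¹Q′G′f` APPLIED TO A CONTINUOUS FAMILY IS CONTINUOUS IN THE BACKGROUND.**
[cite: Balaban1985BackgroundPropagators, (3.25) p.394] -/
theorem continuousAt_Rop {F : Z → suppSub (𝔸 := 𝔸) s} (hF : ContinuousAt F z₀) :
    ContinuousAt (fun z => Rop L (U z) η τ hτp m a Λ s hd hη hτt hτs (hUu z) ha (hinj z) (F z)) z₀ := by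
  unfold Rop
  exact hF.sub (continuousAt_GpZd (hU := hU) (τ := τ) (hτp := hτp) (L := L) (η := η) (m := m) (a := a) (Λ := Λ) (s := s) (hbgT := hbgT) (hd := hd) (hη := hη) (hτt := hτt) (hτs := hτs) (hUu := hUu) (ha := ha)
    (continuousAt_QprimeStar (τ := τ) (hτp := hτp) (L := L) (m := m) (Λ := Λ) (s := s) (hbgT := hbgT)
      (continuousAt_cZd (hU := hU) (τ := τ) (hτp := hτp) (L := L) (η := η) (m := m) (a := a) (Λ := Λ) (s := s) (hbgT := hbgT)
        (hd := hd) (hη := hη) (hτt := hτt) (hτs := hτs) (hUu := hUu) (ha := ha) (hinj := hinj)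
        (continuousAt_QprimeVec (L := L) (m := m) (Λ := Λ) (s := s) (hbgT := hbgT)
          (continuousAt_GpZd (hU := hU) (τ := τ) (hτp := hτp) (L := L) (η := η) (m := m) (a := a) (Λ := Λ) (s := s) (hbgT := hbgT) (hd := hd) (hη := hη) (hτt := hτt) (hτs := hτs) (hUu := hUu) (ha := ha) hF)))))

variable (hT : ∀ (z : Z) (j : ℕ), j ≤ m → ∀ (x y : Site d), bgT L (U z) j x y ∈ unitaryUnits 𝔸)

include hU hbgT hd hη hτt hτs hUu ha hinj hT in
/-- ★★★ **THE LANDAU PROJECTION `R(U)` OF (3.21)–(3.22), APPLIED TO A CONTINUOUS HERMITIAN FAMILY, IS CONTINUOUS IN THE BACKGROUND** — along any family of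
UNITARY backgrounds with the averaged transporters `Ūʲ`, `j ≤ m`, unitary, `Q′*` injective, finite `Ω₀`, finite constraint sets `Λ_j`, `0 < d`, `η ≠ 0`, faithful Hermitian
tracial `τ`: for `g_z` Hermitian-valued with continuous site values, `z ↦ (R(U_z)g_z)(x)` is continuous.  On Hermitian inputs `R(U)` IS the formula (3.25)
(`B9Eq325ProjFormulaZdLevels.projE_eq_Rop_of_herm_le`), continuous by the previous theorem. [cite: Balaban1985BackgroundPropagators, (3.21)–(3.22) p.394, (3.25) p.394] -/
theorem continuousAt_projR_of_herm {g : Z → Site d → 𝔸} (hg : ∀ x : Site d, ContinuousAt (fun z => g z x) z₀)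
    (hherm : ∀ (z : Z) (x : Site d), IsSelfAdjoint (g z x)) (x : Site d) :
    ContinuousAt (fun z => projR τ s L m η (fun j => (↑(Λ j) : Set (Site d))) (U z) (g z) x) z₀ := by
  -- the restricted family in `L²(Ω₀, ·)`
  let F : Z → suppSub (𝔸 := 𝔸) s := fun z =>
    ⟨(↑s : Set (Site d)).indicator (g z), B9Eq321LandauProjectionZd.indicator_mem_suppSub s (g z)⟩
  have hF : ContinuousAt F z₀ := by
    rw [continuousAt_suppSub_iff]
    intro y
    by_cases hy : y ∈ (↑s : Set (Site d))
    · simp only [F, Set.indicator_of_mem hy]; exact hg y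
    · simp only [F, Set.indicator_of_notMem hy]; exact continuousAt_const
  have hFh : ∀ z, starSub (F z) = F z := by
    intro z
    apply Subtype.ext
    funext y
    simp only [F, B9Eq325ProjFormulaZd.coe_starSub, B9Eq325ProjFormulaZd.starFun_apply]
    by_cases hy : y ∈ (↑s : Set (Site d))
    · simp only [Set.indicator_of_mem hy]; exact (hherm z y).star_eq
    · simp only [Set.indicator_of_notMem hy, star_zero]
  have hR := continuousAt_Rop (hU := hU) (τ := τ) (hτp := hτp) (L := L) (η := η) (m := m) (a := a) (Λ := Λ) (s := s) (hbgT := hbgT)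
    (hd := hd) (hη := hη) (hτt := hτt) (hτs := hτs) (hUu := hUu) (ha := ha) (hinj := hinj) hF
  have hRx : ContinuousAt (fun z => ((Rop L (U z) η τ hτp m a Λ s hd hη hτt hτs (hUu z) ha (hinj z) (F z) : suppSub (𝔸 := 𝔸) s) :
      Site d → 𝔸) x) z₀ := (continuousAt_suppSub_iff s).1 hR x
  refine hRx.congr (Eventually.of_forall fun z => ?_)
  show _ = projR τ s L m η (fun j => (↑(Λ j) : Set (Site d))) (U z) (g z) x
  unfold projR
  rw [projE_eq_Rop_of_herm_le L (U z) η τ hτp m a Λ s hd hη hτt hτs (hUu z) ha (hinj z) (hT z) (hFh z)]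

end Carrier

/-! ## §3  The letter `D R(U₀) 𝟙_{Ω₀}D*` of `Δ_a(U₀)` is continuous in the background -/

section Letter

open B7Prop1Explicit
open B7Prop2Explicit (unitaryUnits avgIter)
open B8Eq119TwistedAxial (bgT)
open B8Ineq132 (covDerivFwd covDeriv)
open B8Eq138LandauZd (covDivB)
open B8LeafModelZd (ZdIdx)
open B9SupplySockB9P3ZdLetters (OpsZd)
open B9Eq321LandauProjectionZd (projR star_covDeriv opsLandau opsLandau_DRDs_of_finite)
open B9Eq325QGGQInvZd (QprimeStarInjective)
open B7Eq43AveragingContinuity (continuousAt_hol continuousAt_avgIter)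

variable {d : ℕ} {𝔸 : Type*} [CStarAlgebra 𝔸] {Z : Type*} [TopologicalSpace Z] {z₀ : Z}

/-- **THE AVERAGED TRANSPORTERS `Ū_zʲ(Γ_{y,x})` ARE CONTINUOUS IN THE BACKGROUND** along a family continuous at `z₀`, whenever all loop variables of the lower
averages `Ū_{z₀}ⁱ`, `i < j`, lie in the disc of the series (21) (FILE 3's `continuousAt_avgIter` + `continuousAt_hol`); at the flat background this holds for
every `j`. [cite: Balaban1985Averaging, (43) p.24, (78)–(80) p.30; Balaban1985RegularSpaces, (1.29) p.81] -/
theorem continuousAt_bgT (L : ℕ) {U : Z → Site d → Fin d → 𝔸ˣ} (hU : ContinuousAt U z₀) (j : ℕ)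
    (hsmall : ∀ i, i < j → ∀ (q : Site d) (κ : Fin d) (r : Fin d → Fin L),
      ‖((Wcx L (avgIter L (U z₀) i) q κ (boxVec L r) : 𝔸ˣ) : 𝔸) - 1‖ < 1) (y x : Site d) :
    ContinuousAt (fun z => bgT L (U z) j y x) z₀ := by
  have hV : ContinuousAt (fun z => avgIter L (U z) j) z₀ :=
    ContinuousAt.comp (g := fun V : Site d → Fin d → 𝔸ˣ => avgIter L V j) (f := U) (continuousAt_avgIter L j hsmall) hU
  unfold bgT axialFn
  exact continuousAt_hol hV _ _

/-- **AT THE FLAT BACKGROUND the averaged transporters are continuous at every level** (all averages of `1` are `1`). [cite: Balaban1985Averaging, (43) p.24; Balaban1985RegularSpaces, (1.29) p.81] -/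
theorem continuousAt_bgT_one (L : ℕ) (j : ℕ) (y x : Site d) :
    ContinuousAt (fun U₀ : Site d → Fin d → 𝔸ˣ => bgT L U₀ j y x) 1 := by
  refine continuousAt_bgT L continuousAt_id j (fun i _ q κ r => ?_) y x
  rw [id, B8Ineq132.avgIter_one, B8Ineq130.Wcx_one, Units.val_one, sub_self, norm_zero]
  exact zero_lt_one

/-- `D^{η*}_U A` of a Hermitian bond field at a unitary background is Hermitian-valued. [cite: Balaban1985BackgroundPropagators, p.391 («hermitian»), (3.8) p.392] -/
theorem isSelfAdjoint_covDivB (η : ℝ) {U₀ : Site d → Fin d → 𝔸ˣ} (hU : ∀ (x : Site d) (κ : Fin d), U₀ x κ ∈ unitaryUnits 𝔸)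
    {A : Site d → Fin d → 𝔸} (hA : ∀ (y : Site d) (μ : Fin d), IsSelfAdjoint (A y μ)) (x : Site d) : IsSelfAdjoint (covDivB η U₀ A x) := by
  unfold covDivB IsSelfAdjoint
  rw [star_sum]
  refine Finset.sum_congr rfl fun μ _ => ?_
  rw [star_covDeriv η hU]
  congr 1
  funext w
  exact (hA w μ).star_eq

variable [FiniteDimensional ℝ 𝔸] (τ : 𝔸 →ₗ[ℂ] ℂ) (hτp : ∀ a : 𝔸, a ≠ 0 → 0 < (τ (star a * a)).re)
  (hτt : ∀ a b : 𝔸, τ (a * b) = τ (b * a)) (hτs : ∀ a : 𝔸, τ (star a) = starRingEnd ℂ (τ a))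

include hτt hτs in
/-- ★★★ **THE LETTER `D R(U₀) 𝟙_{Ω₀}D*` OF `Δ_a(U₀)` (this seat's g0 `opsLandau`, the third letter of `opsAllZd`) IS CONTINUOUS IN THE BACKGROUND**: at a member with
finite `Ω₀` whose level-`m` constraint sets are finite (`i.Λs m j = Λ_j`), along a family `U` of UNITARY backgrounds continuous at `z₀` with the averaged
transporters `Ūʲ`, `j ≤ m`, unitary and continuous at `z₀`, `Q′*` injective, `0 < d`, tracial Hermitian faithful `τ`: for every HERMITIAN bond field `A` and every
bond, `z ↦ (D^η_{U_z} R(U_z) 𝟙_{Ω₀}D^{η*}_{U_z} A)(b)` is continuous at `z₀`. [cite: Balaban1985BackgroundPropagators, (3.26) p.395 («D^η_U R(U) D^{η*}_U»), (3.20)–(3.25) p.394] -/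
theorem continuousAt_DRDs_opsLandau {L : ℕ} (ops₀ : ℝ → ZdIdx d L → ℕ → OpsZd d 𝔸) (M : ℝ) (i : ZdIdx d L) (m : ℕ) (hΩ : (i.Ω 0).Finite)
    {Λ : ℕ → Finset (Site d)} (hΛ : i.Λs m = fun j => (↑(Λ j) : Set (Site d)))
    {U : Z → Site d → Fin d → 𝔸ˣ} (hU : ContinuousAt U z₀)
    (hbgT : ∀ j, j < m + 1 → ∀ (y x : Site d), ContinuousAt (fun z => bgT L (U z) j y x) z₀) (hd : 0 < d)
    (hUu : ∀ (z : Z) (x : Site d) (κ : Fin d), U z x κ ∈ unitaryUnits 𝔸) (hinj : ∀ z : Z, QprimeStarInjective L (U z) τ hτp m Λ hΩ.toFinset)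
    (hT : ∀ (z : Z) (j : ℕ), j ≤ m → ∀ (x y : Site d), bgT L (U z) j x y ∈ unitaryUnits 𝔸)
    {A : Site d → Fin d → 𝔸} (hA : ∀ (y : Site d) (μ : Fin d), IsSelfAdjoint (A y μ)) (x : Site d) (μ : Fin d) :
    ContinuousAt (fun z => (opsLandau τ ops₀ M i m).DRDs (U z) A x μ) z₀ := by
  simp only [opsLandau_DRDs_of_finite τ ops₀ M i m hΩ, hΛ]
  have hR : ∀ y : Site d, ContinuousAt
      (fun z => projR τ hΩ.toFinset L m i.η (fun j => (↑(Λ j) : Set (Site d))) (U z) (covDivB i.η (U z) A) y) z₀ :=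
    fun y => continuousAt_projR_of_herm (hU := hU) (τ := τ) (hτp := hτp) (L := L) (η := i.η) (m := m) (a := fun _ => (0 : ℝ)) (Λ := Λ)
      (s := hΩ.toFinset) (hbgT := hbgT) (hd := hd) (hη := i.hη.ne') (hτt := hτt) (hτs := hτs) (hUu := hUu) (ha := fun _ => le_rfl)
      (hinj := hinj) (hT := hT) (g := fun z => covDivB i.η (U z) A)
      (fun y' => continuousAt_covDivB hU i.η y' (A := fun _ => A) fun _ _ => continuousAt_const)
      (fun z y' => isSelfAdjoint_covDivB i.η (hUu z) hA y') y
  exact continuousAt_covDerivFwd hU i.η μ x (hR _) (hR x)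

end Letter

end Literature.MathematicalPhysics.QuantumFieldTheory.Balaban1983to89.B9Eq325ProjContinuityZd

end
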